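import Literature.AlgebraicGeometry.Frobenioids.BiratUnits
import Mathlib.GroupTheory.MonoidLocalization.GrothendieckGroup
import HarnessLib

/-!
# Frobenioids I, Proposition 4.4 (i)–(iii): divisors of rational functions and the unit sequence

Mochizuki, *The geometry of Frobenioids I: the general theory*, Kyushu J. Math. **62** (2008)
293–400, §4, Proposition 4.4, kurims text pp. 82–85 [cite: MochizukiFrdI2008, Prop. 4.4 p.82].

For a Frobenioid `C → F_Φ` and `A ∈ Ob(C)` the group `O^×(A^birat)` of rational functions at `A`
is constructed in `BiratUnits.lean` (classes of pairs `(α, φ)` of base-equivalent co-angular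
pre-steps into `A`).  Here:

* the *divisor* of a rational function, `O^×(A^birat) → Φ^gp(A)`, `(α, φ) ↦ Φ(α)⁻¹(Div(φ) − Div(α))`
  — the functor `C^birat → F_{Φ^gp}` of Prop. 4.4 (i) ("by assigning to the pair `(α, φ')` the
  element `Φ(α)⁻¹{Div(φ') − deg_Fr(φ') · Div(α)} ∈ Φ(A)^gp`", p. 84) on base-identity linear
  automorphisms: `BiratUnits.divHom`, a group homomorphism;
* its image `divHomRange` (= `Φ^birat(A)` by Prop. 4.4 (iii): "the resulting functor
  `C^birat → F_{Φ^birat}` induces, for each `A^birat`, a surjection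
  `O^×(A^birat) ↠ Φ^birat(A^birat)`"; the subfunctor `Φ^birat` itself is seat L1-t5's
  `biratSubfunctor`, bridge to follow) and its description by germs `mem_divHomRange_iff`;
* the injection `O^×(A) ↪ O^×(A^birat)` of Prop. 4.4 (ii) (`u ↦ (id, u)`): `unitsToBirat`,
  injective because `C` is totally epimorphic;
* exactness (Prop. 4.4 (iii): "whose kernel is the image … of `O^×(A)`"): a rational function has
  trivial divisor iff it comes from `O^×(A)` — by Def. 1.3 (vi) (base-equivalent, metrically
  equivalent co-angular pre-steps differ by a unit) and the sharpness of the divisorial monoid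
  `Φ(A)`: `divHom_eq_one_iff`.

Dictionary: multiplicative notation (`Div(φ) − Div(α) ↦ Div φ / Div α`, `Φ^gp = GrothendieckGroup`).
-/

namespace Literature.AlgebraicGeometry.Frobenioids

open CategoryTheory Opposite

universe w v v' u u'

namespace PreFrobenioid

variable {D : Type u} [Category.{v} D] {Φ : Dᵒᵖ ⥤ CommMonCat.{w}}
  {C : Type u'} [Category.{v'} C] {F : C ⥤ ElemFrobenioid Φ}

/-! ### `(ψ^*)⁻¹ Div(ψ)` of composites -/

namespace RatFrac

variable (F) in
/-- `(ψ^*)⁻¹ Div(ψ)` only depends on the arrow (not on the proof that it is a base-isomorphism).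
[cite: MochizukiFrdI2008, Def. 1.3(iii)] -/
theorem invDiv_congr {B A : C} {ψ ψ' : B ⟶ A} (h : ψ = ψ') (hψ : IsBaseIso F ψ)
    (hψ' : IsBaseIso F ψ') : invDiv F ψ hψ = invDiv F ψ' hψ' := by
  subst h
  rfl

variable (F) in
/-- `(id^*)⁻¹ Div(id) = 0`. [cite: MochizukiFrdI2008, Def. 1.3(iii)] -/
theorem invDiv_id (A : C) (h : IsBaseIso F (𝟙 A)) : invDiv F (𝟙 A) h = 1 := by
  unfold invDiv
  rw [div_id, map_one]

/-- For pre-steps `ε : X → Y`, `α : Y → A`: `α^* ((εα)^*)⁻¹ Div(α ∘ ε) = Div(α) + (ε^*)⁻¹ Div(ε)`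
(Remark 1.1.1 for `Div` of a composite, transported to `Y`). [cite: MochizukiFrdI2008, Rem. 1.1.1]
-/
theorem pull_invDiv_comp {X Y A : C} (ε : X ⟶ Y) (α : Y ⟶ A) (hε : IsPreStep F ε)
    (hα : IsPreStep F α) (h : IsBaseIso F (ε ≫ α)) :
    pull Φ (Base F α) (invDiv F (ε ≫ α) h) = Div F α * invDiv F ε hε.2 := by
  haveI : IsIso (Base F ε) := hε.2
  haveI : IsIso (Base F α) := hα.2
  haveI : IsIso (Base F (ε ≫ α)) := h
  have hinv : CategoryTheory.inv (Base F (ε ≫ α)) =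
      CategoryTheory.inv (Base F α) ≫ CategoryTheory.inv (Base F ε) := by
    apply IsIso.inv_eq_of_hom_inv_id
    rw [base_comp, Category.assoc, IsIso.hom_inv_id_assoc, IsIso.hom_inv_id]
  unfold invDiv
  rw [hinv, ← pull_comp, ← Category.assoc, IsIso.hom_inv_id, Category.id_comp, div_comp, hα.1,
    PNat.one_coe, pow_one, map_mul, ← pull_comp, IsIso.inv_hom_id, pull_id]

end RatFrac

/-! ### The divisor of a rational function -/

variable (F) in
/-- `Φ^gp(A)`, the groupification of the divisor monoid at `A`. [cite: MochizukiFrdI2008, Def.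
1.1(ii)] -/
abbrev PhiGp (A : C) : Type w := Algebra.GrothendieckGroup (Φ.obj (op (baseObj F A)))

namespace RatFrac

variable {A : C}

/-- The divisor of a fraction `(α, φ)`: `(φ^*)⁻¹ Div(φ) − (α^*)⁻¹ Div(α) ∈ Φ^gp(A)` (the formula of
FrdI Prop. 4.4 (i), p. 84, `Φ(α)⁻¹{Div(φ') − deg_Fr(φ')·Div(α)}`, for `φ' = φ` linear and
base-equivalent
to `α`). [cite: MochizukiFrdI2008, Prop. 4.4(i) p.84] -/
noncomputable def div (p : RatFrac F A) : PhiGp F A :=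
  Algebra.GrothendieckGroup.of (invDiv F p.num p.num_mem.2.2) /
    Algebra.GrothendieckGroup.of (invDiv F p.den p.den_mem.2.2)

/-- The divisor is unchanged under refinement of the fraction by a co-angular pre-step `ε` (the
extra
term `(ε^*)⁻¹ Div(ε)` cancels). [cite: MochizukiFrdI2008, Prop. 4.4(i) p.84] -/
theorem div_restrict (p : RatFrac F A) {E : C} (ε : E ⟶ p.src)
    (hε : IsCoAngularPreStep F ε) (h₁ : IsCoAngularPreStep F (ε ≫ p.den))
    (h₂ : IsCoAngularPreStep F (ε ≫ p.num)) (hb : BaseEquivalent F (ε ≫ p.den) (ε ≫ p.num)) :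
    div (⟨E, ε ≫ p.den, ε ≫ p.num, h₁, h₂, hb⟩ : RatFrac F A) = div p := by
  haveI : IsIso (Base F p.den) := p.den_mem.2.2
  -- transport along the bijection `Φ(Base p.den)` = `Φ(Base p.num)`
  have hinj : Function.Injective (pull Φ (Base F p.den)) := by
    intro x y hxy
    have := congrArg (pull Φ (CategoryTheory.inv (Base F p.den))) hxy
    rwa [← pull_comp, ← pull_comp, IsIso.inv_hom_id, pull_id, pull_id] at this
  have hden : pull Φ (Base F p.den) (invDiv F (ε ≫ p.den) h₁.2.2) =
      Div F p.den * invDiv F ε hε.2.2 :=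
    pull_invDiv_comp ε p.den hε.2 p.den_mem.2 _
  have hnum : pull Φ (Base F p.den) (invDiv F (ε ≫ p.num) h₂.2.2) =
      Div F p.num * invDiv F ε hε.2.2 := by
    rw [p.baseEq]
    exact pull_invDiv_comp ε p.num hε.2 p.num_mem.2 _
  have hden' : pull Φ (Base F p.den) (invDiv F p.den p.den_mem.2.2) = Div F p.den := pull_invDiv _ _
  have hnum' : pull Φ (Base F p.den) (invDiv F p.num p.num_mem.2.2) = Div F p.num := by
    rw [p.baseEq]
    exact pull_invDiv _ _
  -- the two cross products agree in `Φ(A)`, hence the quotients agree in `Φ^gp(A)`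
  have key : invDiv F (ε ≫ p.num) h₂.2.2 * invDiv F p.den p.den_mem.2.2 =
      invDiv F p.num p.num_mem.2.2 * invDiv F (ε ≫ p.den) h₁.2.2 := by
    apply hinj
    rw [map_mul, map_mul, hnum, hden', hnum', hden, mul_right_comm, mul_assoc]
  change Algebra.GrothendieckGroup.of _ / Algebra.GrothendieckGroup.of _ =
    Algebra.GrothendieckGroup.of _ / Algebra.GrothendieckGroup.of _
  rw [div_eq_div_iff_mul_eq_mul, ← map_mul, ← map_mul, key]

/-- Refinement-related fractions have the same divisor. [cite: MochizukiFrdI2008, Prop. 4.4(i)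
p.84] -/
theorem div_sound (hF : IsFrobenioid F) {p q : RatFrac F A} (h : Rel p q) : div p = div q := by
  obtain ⟨E, ε, ε', hε, hε', hden, hnum⟩ := h
  have hb : BaseEquivalent F (ε ≫ p.den) (ε ≫ p.num) := by
    change Base F (ε ≫ p.den) = Base F (ε ≫ p.num)
    rw [base_comp, base_comp, p.baseEq]
  have hb' : BaseEquivalent F (ε' ≫ q.den) (ε' ≫ q.num) := by
    change Base F (ε' ≫ q.den) = Base F (ε' ≫ q.num)
    rw [base_comp, base_comp, q.baseEq]
  rw [← div_restrict p ε hε (hε.comp hF p.den_mem) (hε.comp hF p.num_mem) hb,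
    ← div_restrict q ε' hε' (hε'.comp hF q.den_mem) (hε'.comp hF q.num_mem) hb']
  unfold div
  rw [invDiv_congr F hnum (hε.comp hF p.num_mem).2.2 (hε'.comp hF q.num_mem).2.2,
    invDiv_congr F hden (hε.comp hF p.den_mem).2.2 (hε'.comp hF q.den_mem).2.2]

/-- The divisor of the unit fraction is trivial. [cite: MochizukiFrdI2008, Prop. 4.4(i) p.84] -/
theorem div_one (hF : IsFrobenioid F) (A : C) : div (one hF A) = 1 := by
  unfold div
  exact div_self' _

/-- The divisor of a product computed with a refinement datum is the product of the divisors
(functoriality of `C^birat → F_{Φ^gp}`, Prop. 4.4 (i)). [cite: MochizukiFrdI2008, Prop. 4.4(i)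
p.84] -/
theorem div_mulWith (hF : IsFrobenioid F) (p q : RatFrac F A) (R : Refinement p q) :
    div (mulWith hF p q R) = div p * div q := by
  haveI : IsIso (Base F p.den) := p.den_mem.2.2
  haveI : IsIso (Base F q.den) := q.den_mem.2.2
  -- injectivity of transports along base isomorphisms
  have hinj : ∀ {Y : C} (f : baseObj F Y ⟶ baseObj F A) [IsIso f],
      Function.Injective (pull Φ f) := by
    intro Y f _ x y hxy
    have := congrArg (pull Φ (CategoryTheory.inv f)) hxy
    rwa [← pull_comp, ← pull_comp, IsIso.inv_hom_id, pull_id, pull_id] at this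
  -- the middle terms: `invDiv (κ ≫ φ) = invDiv (λ ≫ β)`
  have hmid : invDiv F (R.left ≫ p.num) (R.left_mem.comp hF p.num_mem).2.2 =
      invDiv F (R.right ≫ q.den) (R.right_mem.comp hF q.den_mem).2.2 :=
    invDiv_congr F R.w _ _
  -- expand all composite `invDiv`s after transport to the sources
  have e₁ : pull Φ (Base F p.den) (invDiv F (R.left ≫ p.den) (R.left_mem.comp hF p.den_mem).2.2) =
      Div F p.den * invDiv F R.left R.left_mem.2.2 :=
    pull_invDiv_comp R.left p.den R.left_mem.2 p.den_mem.2 _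
  have e₂ : pull Φ (Base F p.den) (invDiv F (R.left ≫ p.num) (R.left_mem.comp hF p.num_mem).2.2) =
      Div F p.num * invDiv F R.left R.left_mem.2.2 := by
    rw [p.baseEq]; exact pull_invDiv_comp R.left p.num R.left_mem.2 p.num_mem.2 _
  have e₃ : pull Φ (Base F q.den) (invDiv F (R.right ≫ q.den) (R.right_mem.comp hF q.den_mem).2.2) =
      Div F q.den * invDiv F R.right R.right_mem.2.2 :=
    pull_invDiv_comp R.right q.den R.right_mem.2 q.den_mem.2 _
  have e₄ : pull Φ (Base F q.den) (invDiv F (R.right ≫ q.num) (R.right_mem.comp hF q.num_mem).2.2) =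
      Div F q.num * invDiv F R.right R.right_mem.2.2 := by
    rw [q.baseEq]; exact pull_invDiv_comp R.right q.num R.right_mem.2 q.num_mem.2 _
  have f₁ : pull Φ (Base F p.den) (invDiv F p.den p.den_mem.2.2) = Div F p.den := pull_invDiv _ _
  have f₂ : pull Φ (Base F p.den) (invDiv F p.num p.num_mem.2.2) = Div F p.num := by
    rw [p.baseEq]; exact pull_invDiv _ _
  have f₃ : pull Φ (Base F q.den) (invDiv F q.den q.den_mem.2.2) = Div F q.den := pull_invDiv _ _
  have f₄ : pull Φ (Base F q.den) (invDiv F q.num q.num_mem.2.2) = Div F q.num := by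
    rw [q.baseEq]; exact pull_invDiv _ _
  -- in `Φ(A)`: `invDiv(κα) · invDiv(φ) = invDiv(α) · invDiv(κφ)` and
  -- `invDiv(λψ) · invDiv(β) = invDiv(ψ) · invDiv(λβ)`
  have kp : invDiv F (R.left ≫ p.den) (R.left_mem.comp hF p.den_mem).2.2 *
      invDiv F p.num p.num_mem.2.2 = invDiv F p.den p.den_mem.2.2 *
      invDiv F (R.left ≫ p.num) (R.left_mem.comp hF p.num_mem).2.2 := by
    apply hinj (Base F p.den)
    rw [map_mul, map_mul, e₁, f₂, f₁, e₂, mul_right_comm, mul_assoc]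
  have kq : invDiv F (R.right ≫ q.num) (R.right_mem.comp hF q.num_mem).2.2 *
      invDiv F q.den q.den_mem.2.2 = invDiv F q.num q.num_mem.2.2 *
      invDiv F (R.right ≫ q.den) (R.right_mem.comp hF q.den_mem).2.2 := by
    apply hinj (Base F q.den)
    rw [map_mul, map_mul, e₄, f₃, f₄, e₃, mul_right_comm, mul_assoc]
  -- conclude in the group `Φ^gp(A)`
  change Algebra.GrothendieckGroup.of (invDiv F (R.right ≫ q.num) _) /
      Algebra.GrothendieckGroup.of (invDiv F (R.left ≫ p.den) _) =
    Algebra.GrothendieckGroup.of _ / Algebra.GrothendieckGroup.of _ *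
      (Algebra.GrothendieckGroup.of _ / Algebra.GrothendieckGroup.of _)
  have kp' := congrArg (Algebra.GrothendieckGroup.of (M := Φ.obj (op (baseObj F A)))) kp
  have kq' := congrArg (Algebra.GrothendieckGroup.of (M := Φ.obj (op (baseObj F A)))) kq
  rw [map_mul, map_mul] at kp' kq'
  rw [hmid] at kp'
  rw [div_mul_div_comm, div_eq_div_iff_mul_eq_mul]
  calc Algebra.GrothendieckGroup.of (invDiv F (R.right ≫ q.num) _) *
        (Algebra.GrothendieckGroup.of (invDiv F p.den _) *
          Algebra.GrothendieckGroup.of (invDiv F q.den _))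
      = (Algebra.GrothendieckGroup.of (invDiv F (R.right ≫ q.num) _) *
          Algebra.GrothendieckGroup.of (invDiv F q.den _)) *
          Algebra.GrothendieckGroup.of (invDiv F p.den _) := by
        rw [mul_comm (Algebra.GrothendieckGroup.of (invDiv F p.den _)), mul_assoc]
    _ = Algebra.GrothendieckGroup.of (invDiv F q.num _) *
          (Algebra.GrothendieckGroup.of (invDiv F p.den _) *
            Algebra.GrothendieckGroup.of (invDiv F (R.right ≫ q.den) _)) := by
        rw [kq', mul_assoc, mul_comm (Algebra.GrothendieckGroup.of (invDiv F (R.right ≫ q.den) _))]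
    _ = Algebra.GrothendieckGroup.of (invDiv F q.num _) *
          (Algebra.GrothendieckGroup.of (invDiv F (R.left ≫ p.den) _) *
            Algebra.GrothendieckGroup.of (invDiv F p.num _)) := by rw [← kp']
    _ = Algebra.GrothendieckGroup.of (invDiv F p.num _) *
          Algebra.GrothendieckGroup.of (invDiv F q.num _) *
          Algebra.GrothendieckGroup.of (invDiv F (R.left ≫ p.den) _) := by
        rw [mul_comm (Algebra.GrothendieckGroup.of (invDiv F (R.left ≫ p.den) _)), ← mul_assoc,
          mul_comm (Algebra.GrothendieckGroup.of (invDiv F q.num _))]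

end RatFrac

namespace BiratUnits

variable {hF : IsFrobenioid F} {A : C}

variable (hF A) in
/-- **Prop. 4.4 (i)**, on units: the divisor homomorphism `O^×(A^birat) → Φ^gp(A)`,
`[(α, φ)] ↦ (φ^*)⁻¹ Div(φ) − (α^*)⁻¹ Div(α)` (the functor `C^birat → F_{Φ^gp}` on base-identity
linear
automorphisms). [cite: MochizukiFrdI2008, Prop. 4.4(i) p.84] -/
noncomputable def divHom : BiratUnits F hF A →* PhiGp F A where
  toFun := Quotient.lift RatFrac.div fun _ _ h => RatFrac.div_sound hF h
  map_one' := RatFrac.div_one hF A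
  map_mul' x y := by
    obtain ⟨p, rfl⟩ := mk_surjective x
    obtain ⟨q, rfl⟩ := mk_surjective y
    change RatFrac.div (RatFrac.mul hF q p) = RatFrac.div p * RatFrac.div q
    rw [RatFrac.mul, RatFrac.div_mulWith, mul_comm]

/-- The divisor of the class of a fraction. [cite: MochizukiFrdI2008, Prop. 4.4(i) p.84] -/
theorem divHom_mk (p : RatFrac F A) : divHom hF A (mk hF p) = RatFrac.div p := rfl

variable (hF A) in
/-- The image of the divisor map `O^×(A^birat) → Φ^gp(A)` — by **Prop. 4.4 (iii)** ("a surjection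
`O^×(A^birat) ↠ Φ^birat(A^birat)`") this is `Φ^birat(A)`; the subfunctor `Φ^birat ⊆ Φ^gp` itself is
seat L1-t5's `PreFrobenioid.biratSubfunctor` (L1-lead RULING C5′), and the bridge
`(divHom hF A).range = biratSubgroup F (Base A)` is filed once that module lands (its elements are
visibly the same germs `(φ^*)⁻¹Div φ − (α^*)⁻¹Div α`, `mem_divHomRange_iff`).
[cite: MochizukiFrdI2008, Prop. 4.4(iii) p.83] -/
noncomputable abbrev divHomRange : Subgroup (PhiGp F A) := (divHom hF A).range

/-- Tautologically `O^×(A^birat) → divHomRange` is surjective.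
[cite: MochizukiFrdI2008, Prop. 4.4(iii) p.83] -/
theorem divHom_mem_divHomRange (x : BiratUnits F hF A) : divHom hF A x ∈ divHomRange hF A :=
  ⟨x, rfl⟩

/-- The elements of the image of `divHom` are exactly the *germs* `(φ^*)⁻¹Div φ − (α^*)⁻¹Div α` of
pairs of base-equivalent pre-steps `α, φ : A' → A` with `α` co-angular (then `φ` is co-angular too,
Def. 1.3 (iii)(b)) — the description of `Φ^birat(A)` used in the proof of Thm. 5.1 (i), p. 97,
and the generating set of L1-t5's `biratSubfunctor` at `Base A`.
[cite: MochizukiFrdI2008, Prop. 4.4(iii) p.83] -/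
theorem mem_divHomRange_iff (x : PhiGp F A) :
    x ∈ divHomRange hF A ↔ ∃ (Y : C) (δ₁ δ₂ : Y ⟶ A) (h₁ : IsCoAngularPreStep F δ₁)
      (h₂ : IsPreStep F δ₂), BaseEquivalent F δ₁ δ₂ ∧
        x = Algebra.GrothendieckGroup.of (invDiv F δ₁ h₁.2.2) /
          Algebra.GrothendieckGroup.of (invDiv F δ₂ h₂.2) := by
  constructor
  · rintro ⟨u, rfl⟩
    obtain ⟨p, rfl⟩ := mk_surjective u
    exact ⟨p.src, p.num, p.den, p.num_mem, p.den_mem.2, p.baseEq.symm, rfl⟩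
  · rintro ⟨Y, δ₁, δ₂, h₁, h₂, hb, rfl⟩
    have h₂' : IsCoAngularPreStep F δ₂ := ⟨hF.iii_b δ₁ h₁ δ₂, h₂⟩
    exact ⟨mk hF ⟨Y, δ₂, δ₁, h₂', h₁, hb.symm⟩, rfl⟩

/-! ### `O^×(A) ↪ O^×(A^birat)` and exactness -/

variable (hF A) in
/-- The fraction `(id, u)` of a unit `u ∈ O^×(A)`. [cite: MochizukiFrdI2008, Prop. 4.4(ii) p.83] -/
def unitFrac (u : unitsSubgroup F A) : RatFrac F A :=
  ⟨A, 𝟙 A, u.1.hom, isCoAngularPreStep_id hF A, isCoAngularPreStep_of_mem_unitsSubgroup hF u.1 u.2,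
    by change Base F (𝟙 A) = Base F u.1.hom; rw [base_id, u.2.1]⟩

variable (hF A) in
/-- **Prop. 4.4 (ii)**: the natural homomorphism `O^×(A) → O^×(A^birat)`, `u ↦ [(id, u)]` (the
restriction to units of the injection `O^▷(A)^gp ↪ O^×(A^birat)` induced by `C → C^birat`).
[cite: MochizukiFrdI2008, Prop. 4.4(ii) p.83] -/
noncomputable def unitsToBirat : unitsSubgroup F A →* BiratUnits F hF A where
  toFun u := mk hF (unitFrac hF A u)
  map_one' := rfl
  map_mul' u v := by
    -- `[(id, v ≫ u)] = [(id, u)] * [(id, v)]`: compute the product with the refinement `(id, v)`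
    let R : RatFrac.Refinement (unitFrac hF A v) (unitFrac hF A u) :=
      { apex := A, left := 𝟙 A, right := v.1.hom, left_mem := isCoAngularPreStep_id hF A
        right_mem := isCoAngularPreStep_of_mem_unitsSubgroup hF v.1 v.2
        w := by
          change 𝟙 A ≫ v.1.hom = v.1.hom ≫ 𝟙 A
          rw [Category.id_comp, Category.comp_id] }
    rw [mk_mul_mk_eq _ _ R]
    apply sound
    refine ⟨A, 𝟙 A, 𝟙 A, isCoAngularPreStep_id hF A, isCoAngularPreStep_id hF A, ?_, ?_⟩
    · change 𝟙 A ≫ 𝟙 A = 𝟙 A ≫ 𝟙 A ≫ 𝟙 A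
      simp only [Category.id_comp]
    · change 𝟙 A ≫ (u * v).1.hom = 𝟙 A ≫ v.1.hom ≫ u.1.hom
      rfl

/-- **Prop. 4.4 (ii)**: `O^×(A) → O^×(A^birat)` is injective ("the functor `C → C^birat` is
faithful", as `C` is totally epimorphic). [cite: MochizukiFrdI2008, Prop. 4.4(ii) p.83] -/
theorem unitsToBirat_injective : Function.Injective (unitsToBirat hF A) := by
  intro u v huv
  obtain ⟨E, ε, ε', hε, -, h₁, h₂⟩ := mk_eq_mk_iff.mp huv
  have h₁' : (ε : E ⟶ A) = ε' := by
    have h := h₁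
    simp only [unitFrac, Category.comp_id] at h
    exact h
  subst h₁'
  have h₂' : ε ≫ u.1.hom = ε ≫ v.1.hom := h₂
  haveI : Epi ε := hF.isPreFrobenioid.isTotallyEpimorphic.epi ε
  exact Subtype.ext (Iso.ext ((cancel_epi ε).mp h₂'))

/-- Arrows of Frobenius degree one that are isomorphisms have trivial zero divisor (a unit of the
sharp monoid `Φ(A)`). [cite: MochizukiFrdI2008, Def. 1.1(i)] -/
theorem div_eq_one_of_mem_unitsSubgroup (hF : IsFrobenioid F) (u : Aut A)
    (hu : u ∈ unitsSubgroup F A) : Div F u.hom = 1 := by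
  apply (hF.isPreFrobenioid.isDivisorial (baseObj F A)).isSharp.eq_one_of_isUnit
  have hinv : u⁻¹ ∈ unitsSubgroup F A := inv_mem hu
  have h := div_comp F u.hom u.inv
  rw [Iso.hom_inv_id, div_id, show degFr F u.inv = 1 from hinv.2, PNat.one_coe, pow_one] at h
  exact IsUnit.of_mul_eq_one_right _ h.symm

/-- **Prop. 4.4 (iii)**, half of the kernel: units of `A` have trivial divisor in `Φ^gp(A)`.
[cite: MochizukiFrdI2008, Prop. 4.4(iii) p.83] -/
theorem divHom_unitsToBirat (u : unitsSubgroup F A) : divHom hF A (unitsToBirat hF A u) = 1 := by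
  change RatFrac.div (unitFrac hF A u) = 1
  unfold RatFrac.div
  have h1 : invDiv F (unitFrac hF A u).num (unitFrac hF A u).num_mem.2.2 = 1 := by
    change invDiv F u.1.hom _ = 1
    unfold invDiv
    rw [div_eq_one_of_mem_unitsSubgroup hF u.1 u.2, map_one]
  have h2 : invDiv F (unitFrac hF A u).den (unitFrac hF A u).den_mem.2.2 = 1 :=
    RatFrac.invDiv_id F A _
  rw [h1, h2, div_self']

/-- **Prop. 4.4 (iii)**, exactness: a rational function with trivial divisor comes from `O^×(A)`
(Def. 1.3 (vi): base-equivalent, metrically equivalent co-angular pre-steps differ by a unit).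
[cite: MochizukiFrdI2008, Prop. 4.4(iii) p.83] -/
theorem divHom_eq_one_iff (x : BiratUnits F hF A) :
    divHom hF A x = 1 ↔ ∃ u : unitsSubgroup F A, unitsToBirat hF A u = x := by
  constructor
  · obtain ⟨p, rfl⟩ := mk_surjective x
    intro h
    change RatFrac.div p = 1 at h
    unfold RatFrac.div at h
    rw [div_eq_one] at h
    have h' :=
      (hF.isPreFrobenioid.isDivisorial (baseObj F A)).isPreDivisorial.isIntegral.injective_of h
    -- `Div φ = Div α`
    have hme : MetricallyEquivalent F p.num p.den := by
      change Div F p.num = Div F p.den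
      rw [← pull_invDiv p.num p.num_mem.2.2, ← pull_invDiv p.den p.den_mem.2.2, h', p.baseEq]
    obtain ⟨u, hu, hcomp⟩ := hF.vi p.num p.den p.num_mem p.den_mem p.baseEq.symm hme
    refine ⟨⟨u, hu⟩, sound ⟨p.src, p.den, 𝟙 _, p.den_mem, isCoAngularPreStep_id hF _, ?_, ?_⟩⟩
    · change p.den ≫ 𝟙 A = 𝟙 _ ≫ p.den
      rw [Category.comp_id, Category.id_comp]
    · change p.den ≫ u.hom = 𝟙 _ ≫ p.num
      rw [hcomp, Category.id_comp]
  · rintro ⟨u, rfl⟩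
    exact divHom_unitsToBirat u

/-- **Prop. 4.4 (iii)** as an exact sequence `1 → O^×(A) → O^×(A^birat) → Φ^birat(A) → 1`: the
kernel
of the divisor map is the image of `O^×(A)`. [cite: MochizukiFrdI2008, Prop. 4.4(iii) p.83] -/
theorem ker_divHom_eq_range : (divHom hF A).ker = (unitsToBirat hF A).range := by
  ext x
  rw [MonoidHom.mem_ker, MonoidHom.mem_range]
  exact divHom_eq_one_iff x

end BiratUnits

end PreFrobenioid

end Literature.AlgebraicGeometry.Frobenioids
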